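import Literature.Analysis.FluidPDE.TsaiSelfSimilarBounded
import Literature.Analysis.FluidPDE.AncientSimilarityVariables
import Literature.Analysis.FluidPDE.AdaptedBackwardKernel
import Literature.Analysis.FluidPDE.SelfSimilar
import HarnessLib

/-!
# Crux `FrequencyRigidity` (stmt-NavierStokesRegularity-2955), line `two-ended-pinning`:
# Stub 3 (`stub_flatEnstrophyLiouville`), NO INSTANTANEOUSLY STEADY SLICE

Helper file (`--supports stmt-NavierStokesRegularity-2955`; theorems only).  Stub 3 of the picked
line forbids a FLAT INHABITANT (classical ancient Navier–Stokes flow `(v, q)` on `ℝ³ × (−∞,0)`,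
`ν > 0`, global time-Type-I bound `‖v(t,x)‖ ≤ C/√(−t)`, scale-invariant bounds, adapted two-sided
Gaussian-comparable kernel `K` at `(0,0)`, EXACT enstrophy law `∫‖curl v(t)‖²K(t) = A(−t)^{−2}`,
`A > 0`, transport-free first variation).  In backward similarity variables
`U(s,y) = e^{−s/2} v(−e^{−s}, e^{−s/2}y)` (`lerayOrbit v`), `(U, P)` solves the backward Leray system
`∂ₛU + ½U + ½(y·∇)U + (U·∇)U + ∇P = νΔU` on all of `ℝ`
(`isClassicalNSSolutionOn_Iio_iff_isBackwardLeraySolutionOn`).  This file proves that a flat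
inhabitant has NO instantaneously steady slice: if `∂ₛU(s₀, ·) ≡ 0` for one `s₀`, then
`(U(s₀), P(s₀))` is a Leray profile with `a = ½`, bounded by `C` (Type I), hence constant by
Tsai 1998 Thm 1 at `q = ∞` (`tsai_selfsimilar_bounded_holds`, PROVED in the tree), so
`curl v(t₀) ≡ 0` at `t₀ = −e^{−s₀}` and the adapted enstrophy vanishes there, contradicting
`A(−t₀)^{−2} > 0`.  (It contains the exactly-self-similar leaf, where EVERY slice is steady; it is
the `α = 0`, one-slice end of the wall the stub contains — rotated self-similar profiles rotate
rigidly and are steady at no slice unless axisymmetric.)  The same dichotomy step is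
`stub_noSteadySlice` of the sibling line `kernel-fading-memory` (gen 2) and step (1) of
`stub_rotatingWaveReduction` of `moving-adjoint-bernoulli`.

## References

* T.-P. Tsai, Arch. Rational Mech. Anal. 143 (1998) 29–51, Theorem 1 (p. 31). [Tsai1998]
* D. Chae, J. Wolf, Arch. Rational Mech. Anal. 225 (2017) = arXiv:1610.09464, §4 (similarity
  variables). [ChaeWolf2017RemovingDSS]
-/

noncomputable section

namespace Summit.NavierStokesRegularity.NavierStokesRegularity.Theorems.FrequencyRigidity.TwoEndedPinning

open Literature.Analysis.FluidPDE MeasureTheory Set Filter Topology Function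
open scoped RealInnerProductSpace Laplacian ContDiff

/-- **Registered sub-goal `stub_flatEnstrophyLiouville_noSteadySlice` — a flat inhabitant has no
instantaneously steady similarity slice.**  With the nine clauses of the lead's `IsFlatInhabitant`
(verbatim, expanded) and one similarity time `s₀` at which `∂ₛ(lerayOrbit v)(s₀, ·) ≡ 0`:
contradiction (Leray system at `s₀` ⇒ `(U(s₀), P(s₀))` is a bounded Leray profile, `a = ½` ⇒
constant by Tsai 1998 Thm 1, `q = ∞` ⇒ `curl v(−e^{−s₀}) ≡ 0` ⇒ adapted enstrophy `0` there,
against the flat law `A(−t)^{−2} > 0`). [cite: Tsai1998, Thm 1 (p. 31)] -/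
theorem stub_flatEnstrophyLiouville_noSteadySlice :
    ∀ (ν C A : ℝ) (C' : ℕ → ℝ) (v : ℝ → EuclideanSpace ℝ (Fin 3) → EuclideanSpace ℝ (Fin 3))
      (q : ℝ → EuclideanSpace ℝ (Fin 3) → ℝ) (K : ℝ → EuclideanSpace ℝ (Fin 3) → ℝ),
      (0 < ν ∧ Literature.Analysis.FluidPDE.IsClassicalNSSolutionOn (Set.Iio 0) ν 0 v q ∧
          Literature.Analysis.FluidPDE.HasTypeITimeDecay C v ∧
          (∀ k : ℕ, 1 ≤ k → ∀ t : ℝ, t < 0 → ∀ x : EuclideanSpace ℝ (Fin 3),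
            ‖iteratedFDeriv ℝ k (v t) x‖ ≤ C' k * (-t) ^ (-((k : ℝ) + 1) / 2)) ∧
          Literature.Analysis.FluidPDE.IsAdaptedBackwardKernel ν v (Set.Iio 0) 0 0 K ∧
          Literature.Analysis.FluidPDE.IsGaussianComparable K (Set.Iio 0) 0 0 ∧ 0 < A ∧
          (∀ t : ℝ, t < 0 →
            Literature.Analysis.FluidPDE.adaptedEnstrophy v K t = A * (-t) ^ (-(2 : ℝ))) ∧
          (∀ t : ℝ, t < 0 →
            HasDerivAt (Literature.Analysis.FluidPDE.adaptedEnstrophy v K)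
              (∫ x, (2 * (inner ℝ (Literature.Analysis.FluidPDE.curl (v t) x)
                            (fderiv ℝ (v t) x (Literature.Analysis.FluidPDE.curl (v t) x))
                          - ν * Literature.Analysis.FluidPDE.frobeniusNormSq
                            (fderiv ℝ (Literature.Analysis.FluidPDE.curl (v t)) x))) * K t x) t)) →
      ∀ s₀ : ℝ,
        (∀ y : EuclideanSpace ℝ (Fin 3),
          Literature.Analysis.FluidPDE.timeDerivWithin (Set.univ : Set ℝ)
            (Literature.Analysis.FluidPDE.lerayOrbit v) s₀ y = 0) →
        False := by
  intro ν C A C' v q K h s₀ hsteady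
  obtain ⟨hν, hNS, hTI, -, -, -, hA, hflat, -⟩ := h
  have hhalf : (0 : ℝ) < 1 / 2 := by norm_num
  -- the backward Leray system in similarity variables
  have hBL : IsBackwardLeraySolutionOn univ ν (lerayOrbit v) (lerayOrbitPressure q) :=
    isClassicalNSSolutionOn_Iio_iff_isBackwardLeraySolutionOn.1 hNS
  set U : EuclideanSpace ℝ (Fin 3) → EuclideanSpace ℝ (Fin 3) := lerayOrbit v s₀ with hU
  set P : EuclideanSpace ℝ (Fin 3) → ℝ := lerayOrbitPressure q s₀ with hP
  have hU2 : ContDiff ℝ 2 U := (hBL.contDiff_velocity (mem_univ s₀)).of_le (by norm_cast)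
  have hP1 : ContDiff ℝ 1 P := (hBL.contDiff_pressure (mem_univ s₀)).of_le (by norm_cast)
  -- at the steady slice the Leray system is the profile system with `a = ½`
  have hprof : IsLerayProfile ν (1 / 2) U P := by
    refine ⟨hU2, hP1, fun y => ?_, hBL.divFree s₀ (mem_univ s₀)⟩
    have hm := hBL.momentum_leray (mem_univ s₀) y
    rw [hsteady y, zero_add] at hm
    rw [← hm]
    abel
  -- boundedness of the slice from the Type-I bound
  set t₀ : ℝ := -Real.exp (-s₀) with ht₀
  have ht₀neg : t₀ < 0 := neg_neg_of_pos (Real.exp_pos _)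
  have hsq : Real.sqrt (-t₀) = Real.exp (-s₀ / 2) := by
    rw [ht₀, neg_neg, sqrt_exp_neg]
  have hUb : ∃ M : ℝ, ∀ y, ‖U y‖ ≤ M := by
    refine ⟨C, fun y => ?_⟩
    have he : 0 < Real.exp (-s₀ / 2) := Real.exp_pos _
    have h1 := hTI t₀ ht₀neg (Real.exp (-s₀ / 2) • y)
    rw [hsq, le_div_iff₀ he] at h1
    calc ‖U y‖ = Real.exp (-s₀ / 2) * ‖v t₀ (Real.exp (-s₀ / 2) • y)‖ := by
          rw [hU, lerayOrbit_apply, norm_smul, Real.norm_of_nonneg he.le]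
      _ = ‖v t₀ (Real.exp (-s₀ / 2) • y)‖ * Real.exp (-s₀ / 2) := mul_comm _ _
      _ ≤ C := h1
  -- Tsai 1998, Theorem 1 (`q = ∞`)
  obtain ⟨c, hc⟩ := tsai_selfsimilar_bounded_holds hν hhalf hprof hUb
  -- the physical slice at `t₀ = −e^{−s₀}` is spatially constant, hence irrotational
  have hlog : -Real.log (-t₀) = s₀ := by rw [ht₀, neg_neg, Real.log_exp, neg_neg]
  have hvt : v t₀ = fun _ => (Real.sqrt (-t₀))⁻¹ • c := by
    funext x
    rw [← ofLerayOrbit_lerayOrbit v ht₀neg x, ofLerayOrbit_apply, hlog]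
    change (Real.sqrt (-t₀))⁻¹ • U ((Real.sqrt (-t₀))⁻¹ • x) = _
    rw [hc]
  have hcurl : ∀ x, curl (v t₀) x = 0 := fun x => by
    rw [hvt]; simp [curl]
  have hH0 : adaptedEnstrophy v K t₀ = 0 := by
    rw [adaptedEnstrophy_apply]
    simp [hcurl]
  -- against the flat law
  have h1 := hflat t₀ ht₀neg
  rw [hH0] at h1
  have hpos : 0 < A * (-t₀) ^ (-(2 : ℝ)) := mul_pos hA (Real.rpow_pos_of_pos (neg_pos.2 ht₀neg) _)
  linarith

end Summit.NavierStokesRegularity.NavierStokesRegularity.Theorems.FrequencyRigidity.TwoEndedPinning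

end
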